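import Summits.NavierStokesRegularity.NavierStokesRegularity.Theorems.AxisTwistDoorAveragedConeLiouvilleShellLidNull
import Summits.NavierStokesRegularity.NavierStokesRegularity.Theorems.AxisTwistDoorAveragedConeLiouvilleShellGradBound
import Summits.NavierStokesRegularity.NavierStokesRegularity.Theorems.AxisTwistDoorAveragedConeLiouvilleShellRadialGap
import Summits.NavierStokesRegularity.NavierStokesRegularity.Theorems.AxisTwistDoorAveragedConeLiouvilleShellStability
import Summits.NavierStokesRegularity.NavierStokesRegularity.Theorems.AxisTwistDoorAveragedConeLiouvilleShellFactOfAtoms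
import HarnessLib

/-!
# Route `AxisTwistDoor`, crux `AveragedConeLiouville` (stmt-NavierStokesRegularity-26889) — INPUT N3: `ShellFact` HOLDS (closer T0′)

N3 cut of record (pub/ns-inputs STATUS 2026-08-28T12:41:44Z, texts OK 12:52:02Z; `kits/N3-skeleton.lean` 815f0a7c119d2985).
The four pieces of the compactness–contradiction route are in the tree BY NAME — S1 `Shell.lidNull` (CKN Theorem B at the lid,
`…ShellLidNull`), S2 `Shell.gradBound` (bounded-solution regularity with norms, `…ShellGradBound`), S3 `Shell.radialGap`
(radial gap of a compact `𝒫¹`-null set, `…ShellRadialGap`), S4 `Shell.stability` (persistence of singularities at a general vertex,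
`…ShellStability`) — and S5 `Shell.shellFact_of_atoms` (`…ShellFactOfAtoms`) assembles them into the route's regular-shell input
`ShellFact` (`AxisTwistDoorAveragedConeLiouvilleDefs`: uniform bounds for `v` and `∇v` on a lateral shell `{a-δ < r < a+δ, |z| < a+δ}`,
`2/3 < a < 4/5`, `δ ≥ δ₀(I₀)`, for every member of the Type I class `InClass C` with `𝐈 ≤ I₀`).  This file is the one-line composition.

* **`shellFact_holds : ShellFact`**.

No NS regularity statement is proved here: `ShellFact` is an INPUT of the line; item 26889 (`AveragedConeLiouville`) and the summit stay
OPEN until the LEAD's re-plug through `ShellFact`.  `--supports stmt-NavierStokesRegularity-26889 --as helper`.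
[cite: AlbrittonBarker2019, Prop. 2.3; CaffarelliKohnNirenberg1982, Theorem B; SereginSverak2009, §2 p. 8]
-/

noncomputable section

-- the summit and its single sub-problem share the name (CONVENTIONS §1)
set_option linter.dupNamespace false

namespace Summit.NavierStokesRegularity.NavierStokesRegularity.Theorems.AveragedConeLiouville.Shell

open Summit.NavierStokesRegularity.NavierStokesRegularity.Theorems.AxisTwistDoorAveragedConeLiouvilleDefs

/-- **T0′ — the regular-shell input `ShellFact` of route `AxisTwistDoor` / crux `AveragedConeLiouville` holds**, by the N3
compactness–contradiction assembly `shellFact_of_atoms` applied to the four landed pieces `lidNull`, `gradBound`, `radialGap`,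
`stability`. [cite: AlbrittonBarker2019, Prop. 2.3; CaffarelliKohnNirenberg1982, Theorem B; SereginSverak2009, §2 p. 8] -/
theorem shellFact_holds : ShellFact :=
  shellFact_of_atoms lidNull gradBound radialGap stability

end Summit.NavierStokesRegularity.NavierStokesRegularity.Theorems.AveragedConeLiouville.Shell

end
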